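import Summits.QuantumFields.YangMills.Theorems.BalabanUVNodesN07ShearedFrameLetters
import Summits.QuantumFields.YangMills.Theorems.BalabanUVNodesN07DbarDictionaryTransfer
import Summits.QuantumFields.YangMills.Theorems.BalabanUVNodesK0Stub1DoubleBarFramesSU
import Summits.QuantumFields.YangMills.Theorems.UnitScaleTiltProp8ChartDoubleBarOneStep
import HarnessLib

/-!
# N07 [B11] (= [15] = [Balaban1985Variational]) Sect. F — plan g93 WORD A3⁵ = ρ3, (c-iii) part 2: **THE (L1″) FRAME BRIDGE FROM FLAT READS** — generic `P` with `L ≥ 13`, `N ≥ 1`: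
# for an `SU(N)` fine field `U` within `s₀` of `1` on the fine bonds under a set `T` of top sites (level `j ≤ m+K`) and EVERY family `V` of UST's accumulated double-bar frames of `U♮`,
# `‖V_i(z) − S_i(U)(z)‖ ≤ φ_i` at every site `z` of level `i ≤ j` lying under `T`, `S = shearRIter` ([3] (85)) for the averaging of record, the averaged contour datum of [I] (0.11) and
# `exp[mean log]`; the letters of ✓`…N07DbarFrameTowerBridge.norm_accFrame_sub_shearRIter_le` are ALL discharged from `s₀`: `p_i := 8σ_i`, `t_i := 12σ_i`, `σ_i := 120ℓ²Lⁱs₀`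
# (`ℓ = (d+2)L`), under four numeric guards at the top level; `φ` is any majorant closing (L1″)'s recursion (closed form in part 3)

Cell `pub-ymgap`, seat `pub-ymgap-dag-n07-e` g30 (FAN-OUT §N07 row s3; LANE OWNER of the K0 road chart side).  `--kind proof --supports stmt-QuantumFields-20541 --as helper` (K0⁷);
count-neutral; THEOREMS ONLY (0 `def`).  [3] = [Balaban1985Averaging]; [I] = [Balaban1987RG1]; [15] = [Balaban1985Variational]; [4] = [Balaban1984PropagatorsII].

WHY.  Under ρ3 the chart reads `U̿(U^u)♮ = Ψ⁻¹·[ρ̄⁻¹]·Ū_eml((U^{h̄w})♮)·[ρ̄]·Ψ` (MODULE 93′ ✓p742869) with `Ψ = S⁻¹V`; `‖Ψ − 1‖ = ‖V − S‖` is (L1″)'s `φ`.  (L1″) asks, at the good sites, for: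
the dictionary `Ū^{(i)}_{eml}(U♮) = (M^iU)♮` on block bonds, unitarity of `V`, Federbush-small stair families of `M^iU` with relative deviation `p_i`, and print's sheared one-block family
within `t_i`.  At the record `U := U^u` (the Landau copy), and (T1)∕(T2) give `‖U^u(b) − 1‖ ≤ s₀` on the fine region under print's window; everything else is UST's flat near-flatness
(`norm_emlIterU_sub_one_le_of_reads`: level-`i` averages within `30ℓLⁱs₀`, k-uniformly), the guarded∕unguarded dictionary (dag-n07-w2's induction, here for a SET of top sites),
UST's stair window (`norm_holT_stair_sub_one_le`: stairs within `4ℓ·30ℓLⁱs₀ =: σ_i`), k0-s1-w1's `suN_vframeU_dbarIterU` (frames in `SU(N)`), and part 1's letters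
(✓`…N07ShearedFrameLetters.sheared_family_letters` with `s_i := (5∕2)σ_i`, closed by `L ≥ 13`: `(5∕2 + 24 + 1152σ_i)·σ_i ≤ (5∕2)·L·σ_i`).

WHAT IS PROVED (sorry-free; axioms standard; generic `P`).
* §1 ★★ `emlIterU_unitsField_eq_iter_of_reads_set` — dag-n07-w2's dictionary `emlIterU_unitsField_eq_iter_of_reads` with the read territory a SET `T` of top sites (proof verbatim, the
  two-point set `{e₋, e₊}` replaced by `T`): for `i ≤ j` and every `i`-bond under `T`, `Ū^{(i)}_{eml}(U♮)(b) = (M^iU)♮(b)` and `‖M^iU(b) − 1‖ ≤ 30ℓLⁱs₀`.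
* §2 the good region `z ↦ (every fine site over z has its j-block point in T)` is closed under centres and block sites (`good_emb`, `good_blockSite`, `good_of_blockOf`); ★ `val_accFrame_mem_unitary`
  (UST's accumulated frames are unitary on it, induction with `suN_vframeU_dbarIterU`); ★ `norm_stairFamily_iter_sub_one_le` (the stair letter `σ_i = 120ℓ²Lⁱs₀`).
* §3 ★★★ `norm_accFrame_sub_shearRIter_le_of_reads` — (L1″) with every structural hypothesis discharged from the reads; remaining displayed: the four guards
  `8·3800·ℓ²·Lʲ·s₀ ≤ 1`, `30ℓ²Lʲs₀ < δ_N`, `24σ_j < δ_F`, `12σ_j < δ_N` and the majorant `φ` with its recursion and `24σ_i + 3φ_i ≤ 1∕24`.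
HONEST SCOPE: bookkeeping over landed UST ∕ k0-s1 ∕ n07-w2 lemmas and parts 1 + (L1″); nothing of [15]∕[3]∕[I] analysis asserted beyond them; the record instantiation (`U := U^u`, `T :=`
print's window, `s₀` from (T1)∕(T2)) is the consumer's one-liner; K0⁷ NOT closed; N07 NOT discharged; counts unmoved; one finite 𝕋⁴ programme at fixed ε — the route closes the conditional
finite-𝕋⁴ rung `BalabanLadder.UV` ONLY; the YM mass gap (Clay) is NOT proved by any of this; nothing continuum ∕ ℝ⁴ ∕ OS.  No `def`, no `instance`, no `notation`, no `sorry`.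

References: [3] (8)–(11) p. 19, (26)–(27) p. 22, (78)–(81) p. 30, (85) p. 31, (92) p. 31, (97)–(100) p. 32, (110) p. 34, Prop. 4 (134)–(135) p. 38; [I] (0.3)–(0.11) pp. 252–253;
[15] (150)–(154) pp. 301–302; [4] (1.18) p. 221.
-/

set_option autoImplicit false

noncomputable section

open scoped BigOperators Matrix.Norms.L2Operator
open NormedSpace

namespace Summit.QuantumFields.YangMills.BalabanUVNodes.N07DbarFrameTowerOfReads

open Literature.MathematicalPhysics.QuantumFieldTheory.Balaban1983to89
open Literature.MathematicalPhysics.QuantumFieldTheory.Balaban1983to89.Node00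
open T4Continuum BlockAveraging ExpMeanLog MatrixLog FederbushMean
open B10Eq27TorusAxialLog (holT unitsField toUField suIncl val_unitsField val_holT_unitsField holT_toUField)
open B5Eq118OneStroke (iterBlockOf iterBlockOf_succ iterBlockOf_zero)
open BlockAveragingEMLLinearised (length_walk)
open LatticeWordStokes (length_loopWord_le)
open Summit.QuantumFields.YangMills.Theorems.Prop8Chart
open Summit.QuantumFields.YangMills.Theorems.Prop8ChartDoubleBar (vframeU dbarIterU norm_holT_stair_sub_one_le)
open Summit.QuantumFields.YangMills.Theorems.K0UniformFluxConfig (dist1_holAt_le_length_mul)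
open Summit.QuantumFields.YangMills.Theorems.K0Stub1DoubleBarFramesSU (suN_vframeU_dbarIterU)
open Summit.QuantumFields.YangMills.BalabanUVNodes.N07SymContourData (permEnum stairFamily symContourData)
open Summit.QuantumFields.YangMills.BalabanUVNodes.N07ShearedFrameLetters (sheared_family_letters coe_mem_unitary)
open Summit.QuantumFields.YangMills.BalabanUVNodes.N07DbarFrameTowerBridge (norm_accFrame_sub_shearRIter_le)

variable {P : Params} {N : ℕ} [NeZero N]

/-! ## §1  The dictionary on the sites under a set of top sites -/

/-- ★★ **THE LOCAL DICTIONARY UNDER A SET OF TOP SITES** (dag-n07-w2's `emlIterU_unitsField_eq_iter_of_reads`, read territory := the fine bonds whose two ends have their `j`-block points in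
`T`; proof verbatim with the two-point set replaced by `T`): `j ≤ m + K`, `0 ≤ s₀`, `6400ℓ²Lʲs₀ ≤ 1`, `30ℓ²Lʲs₀ < δ_N`, `‖U(b) − 1‖ ≤ s₀` on those bonds ⇒ for every `i ≤ j` and every `i`-bond
`b` under `T`: `Ū^{(i)}_{eml}(U♮)(b) = (M^iU)♮(b)` and `‖M^iU(b) − 1‖ ≤ 30ℓLⁱs₀` (`M = Averaging.iter (blockAvg expMeanLogSU)`).
[cite: Balaban1987RG1, (0.4) p.253, (0.11) p.253; Balaban1985Averaging, Prop. 4 (134)–(135) p.38; Balaban1984PropagatorsII, (1.18) p.221] -/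
theorem emlIterU_unitsField_eq_iter_of_reads_set {j : ℕ} (hj : j ≤ P.m + P.K) (T : Set (Site P j)) (U : GaugeField P 0 (SU N))
    {s₀ : ℝ} (hs₀ : 0 ≤ s₀) (hbudget : 6400 * (((P.d + 2) * P.L : ℕ) : ℝ) ^ 2 * (P.L : ℝ) ^ j * s₀ ≤ 1)
    (hguard : 30 * (((P.d + 2) * P.L : ℕ) : ℝ) ^ 2 * (P.L : ℝ) ^ j * s₀ < deltaSU (Fin N))
    (hU : ∀ b : PBond P 0, iterBlockOf j b.src ∈ T → iterBlockOf j b.tgt ∈ T → ‖((U b : SU N) : Matrix (Fin N) (Fin N) ℂ) - 1‖ ≤ s₀) :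
    ∀ i : ℕ, i ≤ j → ∀ b : PBond P i,
      (∀ x : Site P 0, iterBlockOf i x = b.src → iterBlockOf j x ∈ T) → (∀ x : Site P 0, iterBlockOf i x = b.tgt → iterBlockOf j x ∈ T) →
      emlIterU i (unitsField (toUField U)) b = unitsField (toUField (Averaging.iter (fun _ => blockAvg expMeanLogSU) i U)) b ∧
        ‖((Averaging.iter (fun _ => blockAvg expMeanLogSU) i U b : SU N) : Matrix (Fin N) (Fin N) ℂ) - 1‖ ≤ 30 * (((P.d + 2) * P.L : ℕ) : ℝ) * (P.L : ℝ) ^ i * s₀ := by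
  -- adapted from Summits/QuantumFields/YangMills/Theorems/BalabanUVNodesN07DbarDictionaryTransfer.lean (the two-point read set replaced by `T`)
  set ℓ : ℝ := (((P.d + 2) * P.L : ℕ) : ℝ) with hℓ
  have hL1 : (1 : ℝ) ≤ P.L := by exact_mod_cast P.L_pos
  set Tw : (i : ℕ) → Set (Site P i) := fun i => {y | ∀ x : Site P 0, iterBlockOf i x = y → iterBlockOf j x ∈ T} with hTw
  have hTstep : ∀ (i : ℕ) (y : Site P i) (z : Site P (i + 1)), z ∈ Tw (i + 1) → blockOf y = z → y ∈ Tw i := by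
    intro i y z hz hyz x hx
    exact hz x (by rw [iterBlockOf_succ, hx, hyz])
  have hnear : ∀ i : ℕ, i ≤ j → ∀ b : PBond P i, b.src ∈ Tw i → b.tgt ∈ Tw i →
      ‖((emlIterU i (unitsField (toUField U)) b : (Matrix (Fin N) (Fin N) ℂ)ˣ) : Matrix (Fin N) (Fin N) ℂ) - 1‖ ≤ 30 * ℓ * (P.L : ℝ) ^ i * s₀ := by
    intro i hi b hs ht
    have hbud : 6400 * ℓ ^ 2 * (P.L : ℝ) ^ i * s₀ ≤ 1 := by
      have hpow : (P.L : ℝ) ^ i ≤ (P.L : ℝ) ^ j := pow_le_pow_right₀ hL1 hi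
      have : 6400 * ℓ ^ 2 * (P.L : ℝ) ^ i * s₀ ≤ 6400 * ℓ ^ 2 * (P.L : ℝ) ^ j * s₀ :=
        mul_le_mul_of_nonneg_right (mul_le_mul_of_nonneg_left hpow (by positivity)) hs₀
      exact this.trans hbudget
    refine norm_emlIterU_sub_one_le_of_reads (hi.trans hj) (Tw i) (unitsField (toUField U)) hs₀ hbud (fun b₀ hb₀ hb₀' => ?_) b hs ht
    rw [val_unitsField]
    exact hU b₀ (hb₀ b₀.src rfl) (hb₀' b₀.tgt rfl)
  intro i
  induction i with
  | zero =>
    intro _ b hs ht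
    refine ⟨rfl, ?_⟩
    have h := hU b (hs b.src rfl) (ht b.tgt rfl)
    have h1 : s₀ ≤ 30 * ℓ * (P.L : ℝ) ^ 0 * s₀ := by
      rw [pow_zero, mul_one]
      have hℓ1 : (1 : ℝ) ≤ ℓ := by
        rw [hℓ]; exact_mod_cast Nat.one_le_iff_ne_zero.mpr (Nat.mul_ne_zero (by omega) (by have := P.hL.2; omega))
      nlinarith
    exact h.trans h1
  | succ i ih =>
    intro hi1 c hcs hct
    have hi : i ≤ j := Nat.le_of_succ_le hi1
    have hi1' : i + 1 ≤ P.m + P.K := hi1.trans hj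
    have IHw : ∀ b : PBond P i, (blockOf b.src = c.src ∨ blockOf b.src = c.tgt) → (blockOf b.tgt = c.src ∨ blockOf b.tgt = c.tgt) →
        b.src ∈ Tw i ∧ b.tgt ∈ Tw i := by
      intro b hbs hbt
      refine ⟨?_, ?_⟩
      · rcases hbs with h | h
        · exact hTstep i b.src c.src hcs h
        · exact hTstep i b.src c.tgt hct h
      · rcases hbt with h | h
        · exact hTstep i b.tgt c.src hcs h
        · exact hTstep i b.tgt c.tgt hct h
    have heq : ∀ b : PBond P i, (blockOf b.src = c.src ∨ blockOf b.src = c.tgt) → (blockOf b.tgt = c.src ∨ blockOf b.tgt = c.tgt) →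
        emlIterU i (unitsField (toUField U)) b = unitsField (toUField (Averaging.iter (fun _ => blockAvg expMeanLogSU) i U)) b :=
      fun b hbs hbt => (ih hi b (IHw b hbs hbt).1 (IHw b hbs hbt).2).1
    have hsmall : Small (expMeanLogSU (n := Fin N)) (Averaging.iter (fun _ => blockAvg expMeanLogSU) i U) c := by
      intro idx
      show dist1 (holAt (Averaging.iter (fun _ => blockAvg expMeanLogSU) i U) (walk (emb c.src) (loopWord P.L c.dir (off idx.1) idx.2.1 idx.2.2))) <
        (expMeanLogSU (n := Fin N)).δ
      rw [expMeanLogSU_δ]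
      have hsteps : ∀ s ∈ walk (emb c.src) (loopWord P.L c.dir (off idx.1) idx.2.1 idx.2.2),
          dist1 (Averaging.iter (fun _ => blockAvg expMeanLogSU) i U s.bond) ≤ 30 * ℓ * (P.L : ℝ) ^ i * s₀ := by
        intro s hs
        have hbs := blockOf_src_of_mem_walk hi1' c idx s hs
        have hbt := T4ReflectionConeSharp.blockOf_tgt_of_mem_walk hi1' c idx s hs
        obtain ⟨hsT, htT⟩ := IHw s.bond hbs hbt
        have h := hnear i hi s.bond hsT htT
        rw [heq s.bond hbs hbt, val_unitsField] at h
        exact h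
      have hlen : ((walk (emb c.src) (loopWord P.L c.dir (off idx.1) idx.2.1 idx.2.2)).length : ℝ) ≤ ℓ := by
        rw [length_walk, hℓ]
        exact_mod_cast length_loopWord_le c idx
      have hpow : (P.L : ℝ) ^ i ≤ (P.L : ℝ) ^ j := pow_le_pow_right₀ hL1 hi
      calc dist1 (holAt (Averaging.iter (fun _ => blockAvg expMeanLogSU) i U) (walk (emb c.src) (loopWord P.L c.dir (off idx.1) idx.2.1 idx.2.2)))
          ≤ ((walk (emb c.src) (loopWord P.L c.dir (off idx.1) idx.2.1 idx.2.2)).length : ℝ) * (30 * ℓ * (P.L : ℝ) ^ i * s₀) :=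
            dist1_holAt_le_length_mul _ _ hsteps
        _ ≤ ℓ * (30 * ℓ * (P.L : ℝ) ^ j * s₀) := by
            refine mul_le_mul hlen (mul_le_mul_of_nonneg_right (mul_le_mul_of_nonneg_left hpow (by positivity)) hs₀) (by positivity) (by positivity)
        _ = 30 * ℓ ^ 2 * (P.L : ℝ) ^ j * s₀ := by ring
        _ < deltaSU (Fin N) := hguard
        _ = min (1 / 3) (Real.pi / Fintype.card (Fin N)) := rfl
    have hstep : emlIterU (i + 1) (unitsField (toUField U)) c =
        unitsField (toUField (Averaging.iter (fun _ => blockAvg expMeanLogSU) (i + 1) U)) c := by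
      rw [emlIterU_succ, emlAvgU_congr₂ hi1' c heq]
      apply Units.ext
      rw [coe_emlAvgU_unitsField _ c hsmall, val_unitsField]
      rfl
    refine ⟨hstep, ?_⟩
    have h := hnear (i + 1) hi1 c hcs hct
    rw [hstep, val_unitsField] at h
    exact h

/-! ## §2  The good region under `T`: closure, unitary frames, the stair letter -/

section Good

variable {j : ℕ} (T : Set (Site P j))

/-- The centre of a good block is good. [cite: Balaban1987RG1, (0.1) p.251 (bookkeeping)] -/
theorem good_emb {i : ℕ} (hi : i + 1 ≤ P.m + P.K) (y : Site P (i + 1)) (hy : ∀ x : Site P 0, iterBlockOf (i + 1) x = y → iterBlockOf j x ∈ T) :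
    ∀ x : Site P 0, iterBlockOf i x = emb y → iterBlockOf j x ∈ T :=
  fun x hx => hy x (by rw [iterBlockOf_succ, hx, Site.blockOf_emb hi])

/-- The sites of a good block are good. [cite: Balaban1987RG1, (0.1) p.251 (bookkeeping)] -/
theorem good_of_blockOf {i : ℕ} (y : Site P (i + 1)) (hy : ∀ x : Site P 0, iterBlockOf (i + 1) x = y → iterBlockOf j x ∈ T)
    (z : Site P i) (hz : blockOf z = y) : ∀ x : Site P 0, iterBlockOf i x = z → iterBlockOf j x ∈ T :=
  fun x hx => hy x (by rw [iterBlockOf_succ, hx, hz])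

/-- The block sites of a good block are good. [cite: Balaban1987RG1, (0.1) p.251 (bookkeeping)] -/
theorem good_blockSite {i : ℕ} (hi : i + 1 ≤ P.m + P.K) (y : Site P (i + 1)) (hy : ∀ x : Site P 0, iterBlockOf (i + 1) x = y → iterBlockOf j x ∈ T)
    (r : Fin P.d → Fin P.L) : ∀ x : Site P 0, iterBlockOf i x = Site.blockSite y r → iterBlockOf j x ∈ T :=
  good_of_blockOf T y hy _ (Site.blockOf_blockSite hi y r)

omit [NeZero N] in
/-- A fine bond whose `(i+1)`-block points are a good block is read. [cite: Balaban1984PropagatorsII, (1.18) p.221 (bookkeeping)] -/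
theorem read_of_good {i : ℕ} (U : GaugeField P 0 (SU N)) {s₀ : ℝ}
    (hU : ∀ b : PBond P 0, iterBlockOf j b.src ∈ T → iterBlockOf j b.tgt ∈ T → ‖((U b : SU N) : Matrix (Fin N) (Fin N) ℂ) - 1‖ ≤ s₀)
    (y : Site P (i + 1)) (hy : ∀ x : Site P 0, iterBlockOf (i + 1) x = y → iterBlockOf j x ∈ T)
    (b : PBond P 0) (hbs : iterBlockOf (i + 1) b.src = y) (hbt : iterBlockOf (i + 1) b.tgt = y) :
    ‖((unitsField (toUField U) b : (Matrix (Fin N) (Fin N) ℂ)ˣ) : Matrix (Fin N) (Fin N) ℂ) - 1‖ ≤ s₀ := by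
  rw [val_unitsField]
  exact hU b (hy _ hbs) (hy _ hbt)

/-- ★ **UST's ACCUMULATED FRAMES ARE UNITARY ON THE GOOD REGION** (`V 0 = 1`; `V (i+1) y = V i (ȳ)·v(U̿^{(i)}U♮)(y)` with the frame in `SU(N)` by k0-s1-w1's `suN_vframeU_dbarIterU` under the
reads of the block `y`). [cite: Balaban1985Averaging, (97) p.32, (110) p.34, Prop. 4 (134)–(135) p.38; Balaban1987RG1, (0.9) p.253] -/
theorem val_accFrame_mem_unitary (hj : j ≤ P.m + P.K) (U : GaugeField P 0 (SU N)) {s₀ : ℝ} (hs₀ : 0 ≤ s₀)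
    (hbudget : 8 * 3800 * (((P.d + 2) * P.L : ℕ) : ℝ) ^ 2 * (P.L : ℝ) ^ j * s₀ ≤ 1)
    (hguard8 : 8 * (((P.d + 2) * P.L : ℕ) : ℝ) * (P.L : ℝ) ^ j * s₀ < deltaSU (Fin N))
    (hU : ∀ b : PBond P 0, iterBlockOf j b.src ∈ T → iterBlockOf j b.tgt ∈ T → ‖((U b : SU N) : Matrix (Fin N) (Fin N) ℂ) - 1‖ ≤ s₀)
    (V : (i : ℕ) → Site P i → (Matrix (Fin N) (Fin N) ℂ)ˣ) (hV0 : ∀ x, V 0 x = 1)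
    (hVs : ∀ (i : ℕ) (y : Site P (i + 1)), V (i + 1) y = V i (emb y) * vframeU (dbarIterU i (unitsField (toUField U))) y) :
    ∀ i, i ≤ j → ∀ z : Site P i, (∀ x : Site P 0, iterBlockOf i x = z → iterBlockOf j x ∈ T) →
      ((V i z : (Matrix (Fin N) (Fin N) ℂ)ˣ) : Matrix (Fin N) (Fin N) ℂ) ∈ Matrix.unitaryGroup (Fin N) ℂ := by
  have hL1 : (1 : ℝ) ≤ P.L := by exact_mod_cast P.L_pos
  intro i
  induction i with
  | zero =>
    intro _ z _
    rw [hV0, Units.val_one]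
    exact Submonoid.one_mem _
  | succ i ih =>
    intro hi1 y hy
    have hi1' : i + 1 ≤ P.m + P.K := hi1.trans hj
    have hpow : (P.L : ℝ) ^ (i + 1) ≤ (P.L : ℝ) ^ j := pow_le_pow_right₀ hL1 hi1
    have hb' : 8 * 3800 * (((P.d + 2) * P.L : ℕ) : ℝ) ^ 2 * (P.L : ℝ) ^ (i + 1) * s₀ ≤ 1 :=
      (mul_le_mul_of_nonneg_right (mul_le_mul_of_nonneg_left hpow (by positivity)) hs₀).trans hbudget
    have hg' : 8 * (((P.d + 2) * P.L : ℕ) : ℝ) * (P.L : ℝ) ^ (i + 1) * s₀ ≤ 8 * (((P.d + 2) * P.L : ℕ) : ℝ) * (P.L : ℝ) ^ j * s₀ :=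
      mul_le_mul_of_nonneg_right (mul_le_mul_of_nonneg_left hpow (by positivity)) hs₀
    obtain ⟨sv, hsv⟩ := suN_vframeU_dbarIterU hi1' y (unitsField (toUField U)) hs₀ hguard8 hb' hg'
      (fun b hbs hbt => read_of_good T U hU y hy b hbs hbt) (fun b _ _ => ⟨U b, by rw [val_unitsField]; rfl⟩)
    rw [hVs i y, Units.val_mul, ← hsv]
    exact Submonoid.mul_mem _ (ih (Nat.le_of_succ_le hi1) (emb y) (good_emb T hi1' y hy)) (coe_mem_unitary sv)

/-- ★ **THE STAIR LETTER**: at a good block `y` of level `i+1 ≤ j` every centre stair of `M^iU` is within `σ_i := 120ℓ²Lⁱs₀` of `1` (§1: block bonds within `30ℓLⁱs₀`; UST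
`norm_holT_stair_sub_one_le`: stairs `≤ 4ℓ·` that, window `4ℓ·30ℓLⁱs₀ ≤ 1` from the budget). [cite: Balaban1985Averaging, Prop. 4 (134)–(135) p.38, (110) p.34; Balaban1987RG1, (0.3) p.252] -/
theorem norm_stairFamily_iter_sub_one_le (hj : j ≤ P.m + P.K) (U : GaugeField P 0 (SU N)) {s₀ : ℝ} (hs₀ : 0 ≤ s₀)
    (hbudget : 6400 * (((P.d + 2) * P.L : ℕ) : ℝ) ^ 2 * (P.L : ℝ) ^ j * s₀ ≤ 1)
    (hguard : 30 * (((P.d + 2) * P.L : ℕ) : ℝ) ^ 2 * (P.L : ℝ) ^ j * s₀ < deltaSU (Fin N))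
    (hU : ∀ b : PBond P 0, iterBlockOf j b.src ∈ T → iterBlockOf j b.tgt ∈ T → ‖((U b : SU N) : Matrix (Fin N) (Fin N) ℂ) - 1‖ ≤ s₀)
    {i : ℕ} (hi : i < j) (y : Site P (i + 1)) (hy : ∀ x : Site P 0, iterBlockOf (i + 1) x = y → iterBlockOf j x ∈ T)
    (r : Fin P.d → Fin P.L) (k : Fin ((Nat.factorial P.d - 1) + 1)) :
    ‖((stairFamily (Averaging.iter (fun _ => blockAvg expMeanLogSU) i U) y r k : SU N) : Matrix (Fin N) (Fin N) ℂ) - 1‖ ≤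
      120 * (((P.d + 2) * P.L : ℕ) : ℝ) ^ 2 * (P.L : ℝ) ^ i * s₀ := by
  have hi1' : i + 1 ≤ P.m + P.K := (Nat.succ_le_of_lt hi).trans hj
  have hL1 : (1 : ℝ) ≤ P.L := by exact_mod_cast P.L_pos
  have hℓ0 : (0 : ℝ) ≤ (((P.d + 2) * P.L : ℕ) : ℝ) := Nat.cast_nonneg _
  -- block bonds of `M^iU` within `30ℓLⁱs₀`
  have hbond : ∀ b : PBond P i, blockOf b.src = y → blockOf b.tgt = y →
      ‖((unitsField (toUField (Averaging.iter (fun _ => blockAvg expMeanLogSU) i U)) b : (Matrix (Fin N) (Fin N) ℂ)ˣ) : Matrix (Fin N) (Fin N) ℂ) - 1‖ ≤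
        30 * (((P.d + 2) * P.L : ℕ) : ℝ) * (P.L : ℝ) ^ i * s₀ := by
    intro b hbs hbt
    rw [val_unitsField]
    exact (emlIterU_unitsField_eq_iter_of_reads_set hj T U hs₀ hbudget hguard hU i hi.le b
      (good_of_blockOf T y hy _ hbs) (good_of_blockOf T y hy _ hbt)).2
  -- the window `4ℓ·(30ℓLⁱs₀) ≤ 1`
  have hwin : 4 * (((P.d + 2) * P.L : ℕ) : ℝ) * (30 * (((P.d + 2) * P.L : ℕ) : ℝ) * (P.L : ℝ) ^ i * s₀) ≤ 1 := by
    have hpow : (P.L : ℝ) ^ i ≤ (P.L : ℝ) ^ j := pow_le_pow_right₀ hL1 hi.le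
    have h1 : (P.L : ℝ) ^ i * s₀ ≤ (P.L : ℝ) ^ j * s₀ := mul_le_mul_of_nonneg_right hpow hs₀
    have h2 : (0 : ℝ) ≤ (P.L : ℝ) ^ j * s₀ := by positivity
    calc 4 * (((P.d + 2) * P.L : ℕ) : ℝ) * (30 * (((P.d + 2) * P.L : ℕ) : ℝ) * (P.L : ℝ) ^ i * s₀)
        = 120 * (((P.d + 2) * P.L : ℕ) : ℝ) ^ 2 * ((P.L : ℝ) ^ i * s₀) := by ring
      _ ≤ 120 * (((P.d + 2) * P.L : ℕ) : ℝ) ^ 2 * ((P.L : ℝ) ^ j * s₀) := mul_le_mul_of_nonneg_left h1 (by positivity)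
      _ ≤ 6400 * (((P.d + 2) * P.L : ℕ) : ℝ) ^ 2 * ((P.L : ℝ) ^ j * s₀) :=
          mul_le_mul_of_nonneg_right (mul_le_mul_of_nonneg_right (by norm_num) (sq_nonneg _)) h2
      _ = 6400 * (((P.d + 2) * P.L : ℕ) : ℝ) ^ 2 * (P.L : ℝ) ^ j * s₀ := by ring
      _ ≤ 1 := hbudget
  have hst := (norm_holT_stair_sub_one_le hi1' (S := unitsField (toUField (Averaging.iter (fun _ => blockAvg expMeanLogSU) i U))) y
    (by positivity : (0 : ℝ) ≤ 30 * (((P.d + 2) * P.L : ℕ) : ℝ) * (P.L : ℝ) ^ i * s₀) hwin hbond (r, (permEnum P k, 1))).1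
  have hcoe : ((holT (unitsField (toUField (Averaging.iter (fun _ => blockAvg expMeanLogSU) i U))) (emb y) (stairWord (permEnum P k) (off r)) :
      (Matrix (Fin N) (Fin N) ℂ)ˣ) : Matrix (Fin N) (Fin N) ℂ) = ((stairFamily (Averaging.iter (fun _ => blockAvg expMeanLogSU) i U) y r k : SU N) : Matrix (Fin N) (Fin N) ℂ) := by
    rw [val_holT_unitsField, holT_toUField]
    rfl
  rw [← hcoe]
  exact hst.trans (le_of_eq (by ring))

end Good

/-! ## §3  (L1″) from the reads -/

/-- ★★★ **THE (L1″) FRAME BRIDGE FROM FLAT READS.**  `L ≥ 13`, `j ≤ m+K`, `T` a set of top sites, `U` an `SU(N)` fine field with `‖U(b) − 1‖ ≤ s₀` on the fine bonds under `T`; guards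
`8·3800·ℓ²·Lʲ·s₀ ≤ 1`, `30ℓ²Lʲs₀ < δ_N`, `24σ_j < δ_F`, `12σ_j < δ_N` (`σ_i := 120ℓ²Lⁱs₀`, `δ_F` Federbush's radius, `δ_N` the (0.4) guard); `V` ANY family of accumulated double-bar frames
of `U♮`; `φ` any majorant with `0 ≤ φ_0`, (L1″)'s recursion at `p_i := 8σ_i`, `t_i := 12σ_i`, and `24σ_i + 3φ_i ≤ 1∕24`.  THEN `‖V_i(z) − S_i(U)(z)‖ ≤ φ_i` at every site `z` of level
`i ≤ j` under `T`, `S = shearRIter (blockAvg expMeanLogSU) (symContourData federbushSU) (loopAvgBlockOp expMeanLogSU) U`.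
[cite: Balaban1985Averaging, (85) p.31, (92) p.31, (97)–(100) p.32, (110) p.34, Prop. 4 (134)–(135) p.38; Balaban1987RG1, (0.4)–(0.11) p.253; Balaban1985Variational, (150)–(154) pp.301–302] -/
theorem norm_accFrame_sub_shearRIter_le_of_reads (hL13 : 13 ≤ P.L) {j : ℕ} (hj : j ≤ P.m + P.K) (T : Set (Site P j)) (U : GaugeField P 0 (SU N))
    {s₀ : ℝ} (hs₀ : 0 ≤ s₀)
    (hbudget : 8 * 3800 * (((P.d + 2) * P.L : ℕ) : ℝ) ^ 2 * (P.L : ℝ) ^ j * s₀ ≤ 1)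
    (hguard : 30 * (((P.d + 2) * P.L : ℕ) : ℝ) ^ 2 * (P.L : ℝ) ^ j * s₀ < deltaSU (Fin N))
    (hσF : 24 * (120 * (((P.d + 2) * P.L : ℕ) : ℝ) ^ 2 * (P.L : ℝ) ^ j * s₀) < (federbushSU (n := Fin N)).δ)
    (hσS : 12 * (120 * (((P.d + 2) * P.L : ℕ) : ℝ) ^ 2 * (P.L : ℝ) ^ j * s₀) < deltaSU (Fin N))
    (hU : ∀ b : PBond P 0, iterBlockOf j b.src ∈ T → iterBlockOf j b.tgt ∈ T → ‖((U b : SU N) : Matrix (Fin N) (Fin N) ℂ) - 1‖ ≤ s₀)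
    (V : (i : ℕ) → Site P i → (Matrix (Fin N) (Fin N) ℂ)ˣ) (hV0 : ∀ x, V 0 x = 1)
    (hVs : ∀ (i : ℕ) (y : Site P (i + 1)), V (i + 1) y = V i (emb y) * vframeU (dbarIterU i (unitsField (toUField U))) y)
    (φ : ℕ → ℝ) (hφ0 : 0 ≤ φ 0)
    (hφs : ∀ i, i < j →
      φ i + 64 * (12 * (120 * (((P.d + 2) * P.L : ℕ) : ℝ) ^ 2 * (P.L : ℝ) ^ i * s₀) + φ i) ^ 2 +
        (1 + φ i) * (270000 * (8 * (120 * (((P.d + 2) * P.L : ℕ) : ℝ) ^ 2 * (P.L : ℝ) ^ i * s₀)) *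
          (8 * (120 * (((P.d + 2) * P.L : ℕ) : ℝ) ^ 2 * (P.L : ℝ) ^ i * s₀) + (2 * (12 * (120 * (((P.d + 2) * P.L : ℕ) : ℝ) ^ 2 * (P.L : ℝ) ^ i * s₀)) + 3 * φ i)) ^ 3 +
          4 * (8 * (120 * (((P.d + 2) * P.L : ℕ) : ℝ) ^ 2 * (P.L : ℝ) ^ i * s₀)) ^ 2 * (2 * (12 * (120 * (((P.d + 2) * P.L : ℕ) : ℝ) ^ 2 * (P.L : ℝ) ^ i * s₀)) + 3 * φ i)) ≤ φ (i + 1))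
    (hφsmall : ∀ i, i < j → 2 * (12 * (120 * (((P.d + 2) * P.L : ℕ) : ℝ) ^ 2 * (P.L : ℝ) ^ i * s₀)) + 3 * φ i ≤ 1 / 24) :
    ∀ i, i ≤ j → ∀ z : Site P i, (∀ x : Site P 0, iterBlockOf i x = z → iterBlockOf j x ∈ T) →
      ‖((V i z : (Matrix (Fin N) (Fin N) ℂ)ˣ) : Matrix (Fin N) (Fin N) ℂ) -
        ((shearRIter (fun _ => blockAvg expMeanLogSU) (fun _ => symContourData (federbushSU (n := Fin N))) (loopAvgBlockOp expMeanLogSU) U i z : SU N) : Matrix (Fin N) (Fin N) ℂ)‖ ≤ φ i := by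
  -- letters
  set ℓ : ℝ := (((P.d + 2) * P.L : ℕ) : ℝ) with hℓ
  have hL1 : (1 : ℝ) ≤ P.L := by exact_mod_cast P.L_pos
  have hL13' : (13 : ℝ) ≤ P.L := by exact_mod_cast hL13
  have hℓ0 : (0 : ℝ) ≤ ℓ := Nat.cast_nonneg _
  set σ : ℕ → ℝ := fun i => 120 * ℓ ^ 2 * (P.L : ℝ) ^ i * s₀ with hσ_def
  have hσ0 : ∀ i, 0 ≤ σ i := fun i => by positivity
  have hσmono : ∀ i, i ≤ j → σ i ≤ σ j := fun i hi => by
    have hpow : (P.L : ℝ) ^ i ≤ (P.L : ℝ) ^ j := pow_le_pow_right₀ hL1 hi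
    exact mul_le_mul_of_nonneg_right (mul_le_mul_of_nonneg_left hpow (by positivity)) hs₀
  have hσsucc : ∀ i, σ (i + 1) = (P.L : ℝ) * σ i := fun i => by simp only [hσ_def, pow_succ]; ring
  have hδF : (federbushSU (n := Fin N)).δ ≤ 1 / 100 := by rw [federbushSU_δ]; exact deltaFed_le
  have hσF' : 24 * σ j < (federbushSU (n := Fin N)).δ := hσF
  have hσS' : 12 * σ j < deltaSU (Fin N) := hσS
  have hσtop : σ j < 1 / 2400 := by
    have : 24 * σ j < 1 / 100 := lt_of_lt_of_le hσF' hδF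
    linarith
  -- budgets in the weaker forms
  have hbudget' : 6400 * ℓ ^ 2 * (P.L : ℝ) ^ j * s₀ ≤ 1 := by
    have h0 : (0 : ℝ) ≤ ℓ ^ 2 * (P.L : ℝ) ^ j * s₀ := by positivity
    calc 6400 * ℓ ^ 2 * (P.L : ℝ) ^ j * s₀ = 6400 * (ℓ ^ 2 * (P.L : ℝ) ^ j * s₀) := by ring
      _ ≤ 8 * 3800 * (ℓ ^ 2 * (P.L : ℝ) ^ j * s₀) := by nlinarith
      _ = 8 * 3800 * ℓ ^ 2 * (P.L : ℝ) ^ j * s₀ := by ring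
      _ ≤ 1 := hbudget
  have hguard8 : 8 * ℓ * (P.L : ℝ) ^ j * s₀ < deltaSU (Fin N) := by
    have hℓ1 : (1 : ℝ) ≤ ℓ := by
      rw [hℓ]; exact_mod_cast Nat.one_le_iff_ne_zero.mpr (Nat.mul_ne_zero (by omega) (by have := P.hL.2; omega))
    have h1 : 8 * ℓ * (P.L : ℝ) ^ j * s₀ ≤ 30 * ℓ ^ 2 * (P.L : ℝ) ^ j * s₀ := by
      have h0 : 0 ≤ (P.L : ℝ) ^ j * s₀ := by positivity
      nlinarith [mul_nonneg hℓ0 h0]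
    exact lt_of_le_of_lt h1 hguard
  -- the good region
  have hgood_emb : ∀ i, i < j → ∀ y : Site P (i + 1), (∀ x : Site P 0, iterBlockOf (i + 1) x = y → iterBlockOf j x ∈ T) →
      ∀ x : Site P 0, iterBlockOf i x = emb y → iterBlockOf j x ∈ T :=
    fun i hi y hy => good_emb T ((Nat.succ_le_of_lt hi).trans hj) y hy
  have hgood_block : ∀ i, i < j → ∀ y : Site P (i + 1), (∀ x : Site P 0, iterBlockOf (i + 1) x = y → iterBlockOf j x ∈ T) →
      ∀ r : Fin P.d → Fin P.L, ∀ x : Site P 0, iterBlockOf i x = Site.blockSite y r → iterBlockOf j x ∈ T :=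
    fun i hi y hy r => good_blockSite T ((Nat.succ_le_of_lt hi).trans hj) y hy r
  -- part 1's letters with `s := (5/2)σ`, `t := 12σ`
  have hletters := sheared_family_letters (fun _ => blockAvg expMeanLogSU) U
    (fun i z => ∀ x : Site P 0, iterBlockOf i x = z → iterBlockOf j x ∈ T) j hj hgood_emb hgood_block
    σ (fun i => 5 / 2 * σ i) (fun i => 12 * σ i)
    (fun i hi y hy r k => norm_stairFamily_iter_sub_one_le T hj U hs₀ hbudget' hguard hU hi y hy r k)
    (fun i hi => by have := hσmono i hi.le; linarith [hσF', hσ0 j])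
    (by show (0 : ℝ) ≤ 5 / 2 * σ 0; exact mul_nonneg (by norm_num) (hσ0 0))
    (fun i _ => by show 7 * σ i + 2 * (5 / 2 * σ i) ≤ 12 * σ i; linarith)
    (fun i hi => by show 12 * σ i ≤ 1 / 2; have := hσmono i hi.le; linarith [hσ0 j])
    (fun i hi => by
      show 5 / 2 * σ i + (2 * (12 * σ i) + 8 * (12 * σ i) ^ 2) ≤ 5 / 2 * σ (i + 1)
      rw [hσsucc i]
      have hσi : σ i ≤ 1 / 2400 := (hσmono i hi.le).trans hσtop.le
      nlinarith [hσ0 i])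
  obtain ⟨hfam, hP, hY⟩ := hletters
  -- (L1″)
  exact norm_accFrame_sub_shearRIter_le (fun _ => blockAvg expMeanLogSU) U (unitsField (toUField U)) V hV0 hVs
    (fun i z => ∀ x : Site P 0, iterBlockOf i x = z → iterBlockOf j x ∈ T) j hj hgood_emb hgood_block
    (val_accFrame_mem_unitary T hj U hs₀ hbudget hguard8 hU V hV0 hVs)
    (fun i hi y hy b hbs hbt => (emlIterU_unitsField_eq_iter_of_reads_set hj T U hs₀ hbudget' hguard hU i hi.le b
      (good_of_blockOf T y hy _ hbs) (good_of_blockOf T y hy _ hbt)).1)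
    (fun i => 8 * σ i) (fun i => 12 * σ i) φ hφ0 hφs
    (fun i hi => by show 8 * σ i ≤ 1 / 24; have := hσmono i hi.le; linarith [hσ0 j])
    hφsmall
    (fun i hi => by show 12 * σ i < deltaSU (Fin N); exact lt_of_le_of_lt (by have := hσmono i hi.le; linarith [hσ0 j]) hσS')
    hfam hP hY

end Summit.QuantumFields.YangMills.BalabanUVNodes.N07DbarFrameTowerOfReads

end
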